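import Mathlib.Analysis.Complex.ExponentialBounds
import Mathlib.Analysis.Real.Pi.Bounds
import Mathlib.Data.Nat.Size
import HarnessLib

/-!
# Numerical parameters of the cubic infrastructure walk for `ℚ(∛(ab²))`

Topic `Literature/NumberTheory/CubicFields`. Pure real-variable inequalities behind the choice of
parameters of the quantum regulator algorithm for the pure cubic field `ℚ(∛(ab²))` (walk of
Buchmann–Williams type over lattice codes, Jozsa-style `GiantStepCycle` axioms): with
`|d_K| ≤ 27 a² b²` (`d` below), precision `p ≥ 4 size(ab) + 8` and defect bound
`KInt = 2ᵖ (10 size(ab) + 48)`,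

* `six_mul_log_three_lt_seven` — `6 log 3 < 7` (`3⁶ = 729 < e⁷`);
* `natCast_lt_two_pow_size` — `n < 2 ^ size n` in `ℝ`;
* `walkParams_bounds` — `p ≥ 9`, `d ≤ 2ᵖ`, `2ᵖ (11 log (3√d) + 1) ≤ KInt`,
  `6 log (3√d) ≤ 3 log (27a²b²) + 7`, and `6√d/π ≤ 11 ab ≤ 243 a²b²` (label sizes).

Theorem-only file, Mathlib only.

## References

* R. Jozsa, *Notes on Hallgren's efficient quantum algorithm for solving Pell's equation*,
  arXiv:quant-ph/0302134 (2003), §9. [Jozsa2003]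
-/

namespace Literature.NumberTheory.CubicFields

/-- `6 log 3 < 7` (`3⁶ = 729 < e⁷`). [folklore] -/
theorem six_mul_log_three_lt_seven : 6 * Real.log 3 < 7 := by
  have h : Real.log 729 < 7 := by
    rw [Real.log_lt_iff_lt_exp (by norm_num)]
    have he := Real.exp_one_gt_d9
    have h7 : Real.exp 7 = Real.exp 1 ^ 7 := by rw [← Real.exp_nat_mul]; norm_num
    rw [h7]
    calc (729 : ℝ) < 2.7182818283 ^ 7 := by norm_num
      _ < Real.exp 1 ^ 7 := pow_lt_pow_left₀ he (by norm_num) (by norm_num)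
  have h6 : (6 : ℝ) * Real.log 3 = Real.log 729 := by
    rw [show (729 : ℝ) = 3 ^ 6 by norm_num, Real.log_pow]; norm_num
  linarith

/-- `n < 2 ^ size n`, read in `ℝ`. [folklore] -/
theorem natCast_lt_two_pow_size (n : ℕ) : (n : ℝ) < 2 ^ Nat.size n := by
  exact_mod_cast Nat.lt_size_self n

/-- **The numerical parameters of the cubic walk.** For `a, b ≥ 1`, `p ≥ 4 size(ab) + 8` and
`0 < d ≤ 27 a² b²`: `p ≥ 9`; `d ≤ 2ᵖ`; `2ᵖ (11 log (3√d) + 1) ≤ 2ᵖ (10 size(ab) + 48)` (the defect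
bound); `6 log (3√d) ≤ 3 log (27a²b²) + 7` (the gap bound, `6 log 3 < 7`); `6√d/π ≤ 11 ab ≤ 243 a²b²`
(the label bound). [cite: Jozsa2003, §9 Thm. 5] -/
theorem walkParams_bounds {a b prec : ℕ} (ha : a ≠ 0) (hb : b ≠ 0) (hprec : 4 * Nat.size (a * b) + 8 ≤ prec)
    {d : ℝ} (hd0 : 0 < d) (hd27 : d ≤ 27 * (a : ℝ) ^ 2 * (b : ℝ) ^ 2) :
    9 ≤ prec ∧ d ≤ 2 ^ prec ∧
      2 ^ prec * (11 * Real.log (3 * Real.sqrt d) + 1) ≤ ((2 ^ prec * (10 * Nat.size (a * b) + 48) : ℕ) : ℝ) ∧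
      6 * Real.log (3 * Real.sqrt d) ≤ 3 * Real.log (27 * (a : ℝ) ^ 2 * (b : ℝ) ^ 2) + 7 ∧
      6 * Real.sqrt d / Real.pi ≤ 11 * ((a * b : ℕ) : ℝ) ∧ 11 * ((a * b : ℕ) : ℝ) ≤ 243 * (a : ℝ) ^ 2 * (b : ℝ) ^ 2 := by
  set x : ℝ := ((a * b : ℕ) : ℝ) with hx
  have hx1 : 1 ≤ x := by rw [hx]; exact_mod_cast Nat.one_le_iff_ne_zero.mpr (mul_ne_zero ha hb)
  have hxab : (a : ℝ) ^ 2 * (b : ℝ) ^ 2 = x ^ 2 := by rw [hx]; push_cast; ring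
  have hS1 : 1 ≤ Nat.size (a * b) := Nat.size_pos.mpr (Nat.pos_of_ne_zero (mul_ne_zero ha hb))
  have hxS : x < 2 ^ Nat.size (a * b) := natCast_lt_two_pow_size (a * b)
  have hT2 : (2 : ℝ) ≤ 2 ^ Nat.size (a * b) := by
    calc (2 : ℝ) = 2 ^ 1 := by norm_num
      _ ≤ 2 ^ Nat.size (a * b) := pow_le_pow_right₀ (by norm_num) hS1
  have hp9 : 9 ≤ prec := by omega
  have h2p : (0 : ℝ) < 2 ^ prec := by positivity
  have hd27' : d ≤ 27 * x ^ 2 := by rw [← hxab]; linarith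
  -- `d ≤ 2ᵖ`
  have hdp : d ≤ 2 ^ prec := by
    have h1' : (2 : ℝ) ^ (4 * Nat.size (a * b) + 8) ≤ 2 ^ prec := pow_le_pow_right₀ (by norm_num) hprec
    have h2' : (2 : ℝ) ^ (4 * Nat.size (a * b) + 8) = (2 ^ Nat.size (a * b)) ^ 4 * 256 := by
      rw [show 4 * Nat.size (a * b) + 8 = Nat.size (a * b) * 4 + 8 by ring, pow_add, pow_mul]; norm_num
    have hx2 : x ^ 2 ≤ (2 ^ Nat.size (a * b)) ^ 2 := pow_le_pow_left₀ (by linarith) hxS.le 2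
    have hT1 : (1 : ℝ) ≤ (2 ^ Nat.size (a * b)) ^ 2 := one_le_pow₀ (by linarith)
    calc d ≤ 27 * x ^ 2 := hd27'
      _ ≤ 27 * (2 ^ Nat.size (a * b)) ^ 2 := by linarith
      _ ≤ 256 * ((2 ^ Nat.size (a * b)) ^ 2 * (2 ^ Nat.size (a * b)) ^ 2) := by nlinarith
      _ = (2 ^ Nat.size (a * b)) ^ 4 * 256 := by ring
      _ ≤ 2 ^ prec := by rw [← h2']; exact h1'
  -- `log (3√d) ≤ (size(ab) + 4) log 2`
  have hsqrt : Real.sqrt d ≤ Real.sqrt 27 * x := by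
    calc Real.sqrt d ≤ Real.sqrt (27 * x ^ 2) := Real.sqrt_le_sqrt hd27'
      _ = Real.sqrt 27 * x := by rw [Real.sqrt_mul' _ (by positivity), Real.sqrt_sq (by linarith)]
  have h27 : Real.sqrt 27 < 5.2 := by rw [Real.sqrt_lt' (by norm_num)]; norm_num
  have hlog3d : Real.log (3 * Real.sqrt d) ≤ (Nat.size (a * b) + 4) * Real.log 2 := by
    have h : 3 * Real.sqrt d ≤ 2 ^ (Nat.size (a * b) + 4) := by
      rw [pow_add]; nlinarith [Real.sqrt_nonneg d]
    calc Real.log (3 * Real.sqrt d) ≤ Real.log (2 ^ (Nat.size (a * b) + 4)) := Real.log_le_log (by positivity) h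
      _ = (Nat.size (a * b) + 4) * Real.log 2 := by rw [Real.log_pow]; push_cast; ring
  have hl2 := Real.log_two_lt_d9
  refine ⟨hp9, hdp, ?_, ?_, ?_, ?_⟩
  · push_cast
    refine mul_le_mul_of_nonneg_left ?_ h2p.le
    have hS0 : (0 : ℝ) ≤ Nat.size (a * b) := Nat.cast_nonneg _
    nlinarith
  · have hsq : Real.log (Real.sqrt d) = Real.log d / 2 := Real.log_sqrt hd0.le
    rw [Real.log_mul (by norm_num) (Real.sqrt_pos.mpr hd0).ne', hsq]
    have hmono := Real.log_le_log hd0 hd27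
    have h3 := six_mul_log_three_lt_seven
    linarith
  · have hpi := Real.pi_gt_three
    rw [div_le_iff₀ Real.pi_pos]
    calc 6 * Real.sqrt d ≤ 6 * (Real.sqrt 27 * x) := by linarith only [hsqrt]
      _ ≤ 11 * x * 3 := by nlinarith only [h27, hx1]
      _ ≤ 11 * x * Real.pi := mul_le_mul_of_nonneg_left hpi.le (by positivity)
  · rw [show (243 : ℝ) * (a : ℝ) ^ 2 * (b : ℝ) ^ 2 = 243 * x ^ 2 by rw [mul_assoc, hxab]]
    nlinarith only [hx1]

end Literature.NumberTheory.CubicFields
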